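import Summits.ResolutionOfSingularities.ResolutionOfSingularities.Theorems.EquisingularLiftEquisingularLiftNatSubchainSupplierInvDefs
import Summits.ResolutionOfSingularities.ResolutionOfSingularities.Theorems.EquisingularLiftEquisingularLiftNatConeDeltaRegularTransport
import Summits.ResolutionOfSingularities.ResolutionOfSingularities.Theorems.EquisingularLiftEquisingularLiftNatStrictTransformOffCentre
import Summits.ResolutionOfSingularities.ResolutionOfSingularities.Theorems.EquisingularLiftEquisingularLiftNatCarrierDeltaModelFrame
import Literature.AlgebraicGeometry.Resolution.RegularCentreLocal
import Literature.AlgebraicGeometry.Resolution.AlterationsSectionDivisor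
import Literature.AlgebraicGeometry.Resolution.HypersurfaceRestriction
import Literature.AlgebraicGeometry.Resolution.MarkedIdealsLemmas
import HarnessLib

/-!
# [OURS · L1 W4.5(b) · EL♮(3)] HSUB(ReachTC⁺)₃ — T-PKG-TRANSPORT-SCHEME: a CENTRED PACKAGE survives a regular step ELSEWHERE
# (`TCPlus.CentredPackage` at `p′ ∉ V(ker s)` is transported to the point `p′₂` over `p′` of the blow-up of the section `s`)

Crux `EquisingularLiftNat` = stmt-ResolutionOfSingularities-20038 (child EL♮(3) = stmt-ResolutionOfSingularities-20148), route
EquisingularLift, line `sections`; registered stub `stub_elnat_tcPlusPointResolution`, res-L1-w45b-stub-1's HSUB′(ReachTC⁺)₃ assembly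
(driver p526242, INV DEFS v3 p532383, clause (vi) of `TCPlus.Member` under `inv_step_regular`). Helper file `--supports
stmt-ResolutionOfSingularities-20148 --as helper` by res-D-pv-029 (NAMING by res-L1-w45b-stub-1, 2026-08-27T14:19:08Z; pieces (1)–(6)
there). HONEST FRAMING: OURS (cell res-hironaka, slot W4.5(b)); NOT a statement of any manuscript; AI-written, weaker than expert
review. No `sorry`; standard axioms.

WHAT. `TCPlus.CentredPackage O P q X σ 𝓢 K p′` = a section `s′` through `p′` on `D = V(𝓢 ⊔ K)` with a frame `c : Fin 3` of `(ker s′)_{p′}`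
carrying the order-`m` cone pack `(𝓢_{p′}, K_{p′}) = ((c₀), (Φ(c₁, c₂)))` and `TCPlus.ConeDeltaRegular c Φ`. If the stage is blown up
along the ideal `ker s` of ANOTHER section `s` (`p′ ∉ V(ker s)`) by `τ : X₂ → X`, the package moves to the point `p′₂` over `p′` for the
strict transforms `(St 𝓢, St K)`: (1) `s′` misses `V(ker s)` (every point of `Spec O` specialises to the closed point, and `V(ker s)` is
closed), so `(ker s)·𝒪_{Spec O} = ⊤` is effective Cartier and `s′` LIFTS along `τ` (universal property) to a section `s′₂`, with
`s′₂(s₀) = p′₂` since `τ` is injective off the centre; (2) `τ^♯_{p′₂}` is an isomorphism `e : 𝒪_{X,p′} ≅ 𝒪_{X₂,p′₂}`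
(`IsBlowup.isIso_stalkMap_of_not_mem_support`); (3) `(ker s′₂)_{p′₂} = e((ker s′)_{p′})` (kernels of the stalk maps of the closed
immersions `s′ = s′₂ ≫ τ`, `s′₂`); (4) `St 𝓢 ⊔ St K ≤ ker s′₂` (stalk by stalk on `Spec O` the comap of the strict transforms along
`s′₂` is the comap of `𝓢 ⊔ K` along `s′`, all points of `s′₂` being off the centre); (5) the frame `e ∘ c` and the cone `e(Φ)` carry
every clause (`IsQuasiRegular.map_ringEquiv`, quotient isomorphisms, `stalkIdeal_strictTransformIdeal_of_not_mem_support`);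
(6) `TCPlus.coneDeltaRegular_map_ringEquiv` (res-L1-w45b-stub-2, p536891).

* `apply_notMem_of_closedPoint_notMem` — a morphism from `Spec` of a local ring misses a closed set missed by the closed point;
* `isBlowup_eq_of_base_eq_of_not_mem_support` — a blow-up is injective off the centre;
* `exists_section_lift_of_isBlowup` — piece (1);
* **`centredPackage_strictTransform`** — the statement (res-L1-w45b-stub-1's text verbatim).

References: U. Görtz, T. Wedhorn, *Algebraic Geometry I* (2020), Def. 13.90, Prop. 13.91; The Stacks Project, Tags 02OS, 0806, 01J7.
Tree inputs: p532383 (INV DEFS v3), p536891 (stub-2), …NatStrictTransformOffCentre (stub-1), Literature Blowups / RegularCentreLocal /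
AlterationsSectionDivisor / HypersurfaceRestriction / MarkedIdealsLemmas.
-/

set_option linter.dupNamespace false -- mandated namespace `Summit.<Summit>.<Problem>` of this single-conjunct summit
set_option linter.overlappingInstances false -- signatures carry `[IsDomain O] [IsDiscreteValuationRing O]`

noncomputable section

open CategoryTheory CategoryTheory.Limits AlgebraicGeometry TopologicalSpace Topology IsLocalRing MvPolynomial
open Literature.AlgebraicGeometry.Resolution
open AlgebraicGeometry.Scheme.IdealSheafData

namespace Summit.ResolutionOfSingularities.ResolutionOfSingularities.Cruxes.EquisingularLiftNat.Sections

/-! ## 1. Morphisms from the spectrum of a local ring, and injectivity of a blow-up off its centre -/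

/-- A morphism from `Spec` of a local ring misses every closed set which its closed point misses (every point of `Spec O`
specialises to the closed point). [cite: StacksProject, Tag 01J7] -/
theorem apply_notMem_of_closedPoint_notMem {O : Type} [CommRing O] [IsLocalRing O] {X : Scheme.{0}} (f : Spec (.of O) ⟶ X)
    {Z : Set X} (hZ : IsClosed Z) (h0 : f (closedPoint O) ∉ Z) (t : Spec (.of O)) : f t ∉ Z := fun ht =>
  h0 (((IsLocalRing.specializes_closedPoint t).map f.continuous).mem_closed hZ ht)

/-- **A blow-up is injective off its centre.** [cite: StacksProject, Tag 02OS] -/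
theorem isBlowup_eq_of_base_eq_of_not_mem_support {X X₂ : Scheme.{0}} {τ : X₂ ⟶ X} {J : X.IdealSheafData} (hτ : IsBlowup τ J)
    {a b : X₂} (h : τ a = τ b) (ha : τ a ∉ J.support) : a = b := by
  set W₀ : X.Opens := ⟨(J.support : Set X)ᶜ, J.support.isClosed.isOpen_compl⟩ with hW₀
  haveI : IsIso (τ ∣_ W₀) := hτ.isIso_compl
  have ha' : a ∈ τ ⁻¹ᵁ W₀ := ha
  have hb' : b ∈ τ ⁻¹ᵁ W₀ := by
    change τ b ∈ (J.support : Set X)ᶜ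
    rw [← h]; exact ha
  have hinj := (τ ∣_ W₀).isOpenEmbedding.injective
  have key : (τ ∣_ W₀) ⟨a, ha'⟩ = (τ ∣_ W₀) ⟨b, hb'⟩ := by
    apply Subtype.ext
    rw [morphismRestrict_base_coe, morphismRestrict_base_coe]
    exact h
  exact congrArg Subtype.val (hinj key)

/-! ## 2. Piece (1): the section lifts along the blow-up of another section -/

/-- **A section missing the centre lifts along the blow-up.** `s′ : Spec O → X` with `s′(s₀) ∉ V(J)`, `τ` the blow-up of `J`: then
`J·𝒪_{Spec O} = ⊤` (every point of `Spec O` specialises to `s₀` and `V(J)` is closed), so by the universal property `s′ = s′₂ ≫ τ`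
for a unique `s′₂`, and `s′₂(s₀)` is THE point over `s′(s₀)` (injectivity off the centre). [cite: GortzWedhorn2020, Def. 13.90]
[cite: StacksProject, Tag 0806] -/
theorem exists_section_lift_of_isBlowup {O : Type} [CommRing O] [IsLocalRing O] {X X₂ : Scheme.{0}} {τ : X₂ ⟶ X}
    {J : X.IdealSheafData} (hτ : IsBlowup τ J) (s' : Spec (.of O) ⟶ X) (hs' : s' (closedPoint O) ∉ J.support)
    (p₂ : X₂) (hp₂ : τ p₂ = s' (closedPoint O)) :
    ∃ s₂ : Spec (.of O) ⟶ X₂, s₂ ≫ τ = s' ∧ s₂ (closedPoint O) = p₂ := by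
  have hmiss : ∀ t, s' t ∉ (J.support : Set X) :=
    apply_notMem_of_closedPoint_notMem s' J.support.isClosed hs'
  have htop : J.comap s' = ⊤ := by
    rw [← Scheme.IdealSheafData.support_eq_bot_iff]
    ext t
    simp only [Closeds.coe_bot, Set.mem_empty_iff_false, iff_false]
    intro ht
    have h1 : t ∈ ((J.comap s').support : Set _) := ht
    rw [Scheme.IdealSheafData.support_comap] at h1
    exact hmiss t h1
  have hcart : IsEffectiveCartier (J.comap s') := by rw [htop]; exact isEffectiveCartier_top
  obtain ⟨s₂, hs₂, -⟩ := hτ.universal s' hcart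
  refine ⟨s₂, hs₂, isBlowup_eq_of_base_eq_of_not_mem_support hτ ?_ ?_⟩
  · rw [hp₂, ← hs₂, Scheme.Hom.comp_apply]
  · rw [← Scheme.Hom.comp_apply, hs₂]; exact hs'

/-! ## 3. Ring lemmas: transports along a ring isomorphism -/

section RingTransport

variable {R S : Type} [CommRing R] [CommRing S] (e : R ≃+* S)

/-- `Φ mod I ≠ 0 ⇒ (eΦ) mod e(I) ≠ 0` for a ring isomorphism `e`. [folklore] -/
theorem map_mk_map_ringEquiv_ne_zero {σ : Type*} (I : Ideal R) (J : Ideal S) (hJ : J = I.map (e : R →+* S))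
    (Φ : MvPolynomial σ R) (hΦ : MvPolynomial.map (Ideal.Quotient.mk I) Φ ≠ 0) :
    MvPolynomial.map (Ideal.Quotient.mk J) (MvPolynomial.map (e : R →+* S) Φ) ≠ 0 := by
  have hfac : (Ideal.Quotient.mk J).comp (e : R →+* S) = (Ideal.quotientEquiv I J e hJ).toRingHom.comp (Ideal.Quotient.mk I) := by
    ext a
    exact (Ideal.quotientEquiv_mk I J e hJ a).symm
  rw [MvPolynomial.map_map, hfac, ← MvPolynomial.map_map]
  intro h
  exact hΦ (MvPolynomial.map_injective _ (Ideal.quotientEquiv I J e hJ).injective (h.trans (map_zero _).symm))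

/-- A ring isomorphism of local rings maps the maximal ideal onto the maximal ideal. [folklore] -/
theorem maximalIdeal_eq_map_ringEquiv [IsLocalRing R] [IsLocalRing S] :
    maximalIdeal S = (maximalIdeal R).map (e : R →+* S) := by
  have hsurj : Function.Surjective (e : R →+* S) := e.surjective
  rcases Ideal.map_eq_top_or_isMaximal_of_surjective (e : R →+* S) hsurj (maximalIdeal.isMaximal R) with h | h
  · exfalso
    have h1 : (1 : S) ∈ (maximalIdeal R).map (e : R →+* S) := h ▸ Submodule.mem_top
    rw [Ideal.mem_map_iff_of_surjective _ hsurj] at h1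
    obtain ⟨x, hx, hx1⟩ := h1
    have hx' : x = 1 := e.injective (by rw [map_one]; exact hx1)
    rw [hx'] at hx
    exact (maximalIdeal.isMaximal R).ne_top (Ideal.eq_top_of_isUnit_mem _ hx isUnit_one)
  · exact (IsLocalRing.eq_maximalIdeal h).symm

/-- `Φ mod 𝔪_R ≠ 0 ⇒ (eΦ) mod 𝔪_S ≠ 0` for a ring isomorphism `e` of local rings. [folklore] -/
theorem map_residue_map_ringEquiv_ne_zero [IsLocalRing R] [IsLocalRing S] {σ : Type*} (Φ : MvPolynomial σ R)
    (hΦ : MvPolynomial.map (IsLocalRing.residue R) Φ ≠ 0) :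
    MvPolynomial.map (IsLocalRing.residue S) (MvPolynomial.map (e : R →+* S) Φ) ≠ 0 :=
  map_mk_map_ringEquiv_ne_zero e (maximalIdeal R) (maximalIdeal S) (maximalIdeal_eq_map_ringEquiv e) Φ hΦ

/-- The tail of a frame stays quasi-regular modulo its head after a ring isomorphism. [folklore] -/
theorem isQuasiRegular_tail_map_ringEquiv {r : ℕ} (c : Fin (r + 1) → R)
    (hcb : IsQuasiRegular fun l : Fin r => Ideal.Quotient.mk (Ideal.span {c 0}) (c l.succ)) :
    IsQuasiRegular fun l : Fin r => Ideal.Quotient.mk (Ideal.span {e (c 0)}) (e (c l.succ)) := by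
  have h0 : Ideal.span {e (c 0)} = (Ideal.span {c 0}).map (e : R →+* S) := by
    rw [Ideal.map_span, Set.image_singleton]; rfl
  have h := hcb.map_ringEquiv (Ideal.quotientEquiv _ _ e h0)
  have hfun : (Ideal.quotientEquiv _ _ e h0 ∘ fun l : Fin r => Ideal.Quotient.mk (Ideal.span {c 0}) (c l.succ)) =
      fun l : Fin r => Ideal.Quotient.mk (Ideal.span {e (c 0)}) (e (c l.succ)) := by
    funext l
    exact Ideal.quotientEquiv_mk _ _ e h0 (c l.succ)
  rwa [hfun] at h

/-- The quotient by the transported frame is a domain if the original one is. [folklore] -/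
theorem isDomain_quotient_span_map_ringEquiv {ι : Type*} (c : ι → R) [IsDomain (R ⧸ Ideal.span (Set.range c))] :
    IsDomain (S ⧸ Ideal.span (Set.range fun i => e (c i))) := by
  have h : Ideal.span (Set.range fun i => e (c i)) = (Ideal.span (Set.range c)).map (e : R →+* S) := by
    rw [Ideal.map_span, ← Set.range_comp]; rfl
  exact Function.Injective.isDomain (Ideal.quotientEquiv _ _ e h).symm.toRingHom (Ideal.quotientEquiv _ _ e h).symm.injective

end RingTransport

/-! ## 4. Scheme lemmas for the lifted section -/

/-- **The section ideal at the lifted point**: for `s₂` with `s₂ ≫ τ` and `s₂` closed immersions and `τ^♯` an isomorphism at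
`s₂(s₀)`, `(ker s₂)_{s₂ s₀} = τ^♯((ker (s₂ ≫ τ))_{τ(s₂ s₀)})`. [cite: StacksProject, Tag 01J7] -/
theorem stalkIdeal_ker_eq_map_of_isIso_stalkMap {O : Type} [CommRing O] [IsLocalRing O] {X X₂ : Scheme.{0}} (τ : X₂ ⟶ X)
    (s₂ : Spec (.of O) ⟶ X₂) [IsClosedImmersion s₂] [IsClosedImmersion (s₂ ≫ τ)] [IsIso (τ.stalkMap (s₂ (closedPoint O)))] :
    stalkIdeal s₂.ker (s₂ (closedPoint O)) =
      (stalkIdeal (s₂ ≫ τ).ker (τ (s₂ (closedPoint O)))).map (τ.stalkMap (s₂ (closedPoint O))).hom := by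
  rw [stalkIdeal_ker_eq_ker_stalkMap s₂ (closedPoint O)]
  have h1 := stalkIdeal_ker_eq_ker_stalkMap (s₂ ≫ τ) (closedPoint O)
  rw [Scheme.Hom.stalkMap_comp] at h1
  change stalkIdeal (s₂ ≫ τ).ker (τ (s₂ (closedPoint O))) =
    RingHom.ker ((s₂.stalkMap (closedPoint O)).hom.comp (τ.stalkMap (s₂ (closedPoint O))).hom) at h1
  rw [h1, ← RingHom.comap_ker, Ideal.map_comap_of_surjective _ (ConcreteCategory.bijective_of_isIso (τ.stalkMap _)).2]

/-- **The strict transforms restrict along the lifted section as the pair restricts along the section**: if every point of `s₂`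
lies off the centre, `(St 𝓢 ⊔ St K)|_{s₂} = (𝓢 ⊔ K)|_{s₂ ≫ τ}`. [cite: StacksProject, Tag 02OS] -/
theorem comap_carrierStrictTransform_eq_of_forall_not_mem {O : Type} [CommRing O] {X X₂ : Scheme.{0}} [IsLocallyNoetherian X₂]
    {τ : X₂ ⟶ X} {C : X.IdealSheafData} (𝓢 K : X.IdealSheafData) (s₂ : Spec (.of O) ⟶ X₂) (hoff : ∀ t, τ (s₂ t) ∉ C.support) :
    (strictTransformIdeal τ C 𝓢 ⊔ strictTransformIdeal τ C K).comap s₂ = (𝓢 ⊔ K).comap (s₂ ≫ τ) := by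
  apply ext_of_forall_stalkIdeal_eq
  intro t
  rw [stalkIdeal_comap_eq_map_stalkMap, stalkIdeal_comap_eq_map_stalkMap,
    stalkIdeal_carrierStrictTransform_of_not_mem_support 𝓢 K (hoff t), Ideal.map_map, Scheme.Hom.stalkMap_comp]
  rfl

/-! ## 5. The transport -/

/-- **T-PKG-TRANSPORT-SCHEME: a centred package survives a regular step elsewhere.** Statement = res-L1-w45b-stub-1's NAMING
2026-08-27T14:19:08Z (INV DEFS v3 `TCPlus.CentredPackage`) WITHOUT its hypothesis `hs : s ≫ σ ≫ q = 𝟙` (the transport needs only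
that `τ` is the blow-up of `ker s`, not that `s` is a section); see the module docstring for the six pieces.
[cite: GortzWedhorn2020, Prop. 13.91] [cite: StacksProject, Tag 02OS] [OURS · L1 W4.5b] toward `stub_elnat_tcPlusPointResolution`
(stmt-ResolutionOfSingularities-20148 / -20038); NOT a statement of the manuscript. -/
theorem centredPackage_strictTransform (O : Type) [CommRing O] [IsDomain O] [IsDiscreteValuationRing O] (P : Scheme.{0})
    (q : P ⟶ Spec (.of O)) {X X₂ : Scheme.{0}} [IsLocallyNoetherian X] [IsLocallyNoetherian X₂] (σ : X ⟶ P)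
    [IsSeparated (σ ≫ q)] (s : Spec (.of O) ⟶ X) (τ : X₂ ⟶ X) (hτ : IsBlowup τ s.ker)
    (𝓢 K : X.IdealSheafData) (p' : X) (hp' : p' ∉ (s.ker.support : Set X)) (p'₂ : X₂) (hp'₂ : τ p'₂ = p') :
    TCPlus.CentredPackage O P q X σ 𝓢 K p' → TCPlus.CentredPackage O P q X₂ (τ ≫ σ)
      (strictTransformIdeal τ s.ker 𝓢) (strictTransformIdeal τ s.ker K) p'₂ := by
  classical
  rintro ⟨s', hs', hs'p, hle, c, m, Φ, hcJ, hc, hdom, hcb, h𝓢, hm, hΦd, hK, hΦc, hΦ𝔪, hΔ⟩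
  subst hp'₂
  -- (1) lift the section
  have hs'0 : s' (closedPoint O) ∉ s.ker.support := by rw [hs'p]; exact hp'
  obtain ⟨s₂, hs₂, hs₂pt⟩ := exists_section_lift_of_isBlowup hτ s' hs'0 p'₂ hs'p.symm
  subst hs₂
  subst hs₂pt
  -- every point of the lifted section lies off the centre
  have hoff : ∀ t, τ (s₂ t) ∉ s.ker.support := fun t => by
    have h := apply_notMem_of_closedPoint_notMem (s₂ ≫ τ) s.ker.support.isClosed hs'0 t
    rwa [Scheme.Hom.comp_apply] at h
  -- the sections are closed immersions (sections of separated morphisms)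
  haveI : IsProper τ := hτ.isProper
  haveI : IsClosedImmersion ((s₂ ≫ τ) ≫ σ ≫ q) := by rw [hs']; infer_instance
  haveI : IsClosedImmersion (s₂ ≫ τ) := .of_comp (s₂ ≫ τ) (σ ≫ q)
  haveI : IsSeparated (τ ≫ σ ≫ q) := inferInstance
  haveI : IsClosedImmersion (s₂ ≫ τ ≫ σ ≫ q) := by rw [← Category.assoc, hs']; infer_instance
  haveI : IsClosedImmersion s₂ := .of_comp s₂ (τ ≫ σ ≫ q)
  -- (2) the stalk isomorphism at the point over `p'`
  haveI hiso : IsIso (τ.stalkMap (s₂ (closedPoint O))) := hτ.isIso_stalkMap_of_not_mem_support (hoff _)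
  let e : X.presheaf.stalk (τ (s₂ (closedPoint O))) ≃+* X₂.presheaf.stalk (s₂ (closedPoint O)) :=
    RingEquiv.ofBijective (τ.stalkMap (s₂ (closedPoint O))).hom
      (ConcreteCategory.bijective_of_isIso (τ.stalkMap (s₂ (closedPoint O))))
  have hecoe : (e : X.presheaf.stalk (τ (s₂ (closedPoint O))) →+* X₂.presheaf.stalk (s₂ (closedPoint O))) =
      (τ.stalkMap (s₂ (closedPoint O))).hom := RingHom.ext fun _ => rfl
  -- (3) the section ideal at the point over `p'`
  have hspan₂' : Ideal.span (Set.range fun i => e (c i)) = (Ideal.span (Set.range c)).map (e : _ →+* _) := by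
    rw [Ideal.map_span, ← Set.range_comp]; rfl
  have hspan₂ : Ideal.span (Set.range fun i => e (c i)) = stalkIdeal s₂.ker (s₂ (closedPoint O)) := by
    rw [stalkIdeal_ker_eq_map_of_isIso_stalkMap τ s₂, ← hcJ, hspan₂', hecoe]
  -- (4) the strict transforms lie in `ker s₂`
  have hle₂ : strictTransformIdeal τ s.ker 𝓢 ⊔ strictTransformIdeal τ s.ker K ≤ s₂.ker := by
    rw [le_ker_iff_comap_eq_bot, comap_carrierStrictTransform_eq_of_forall_not_mem 𝓢 K s₂ hoff, ← le_ker_iff_comap_eq_bot]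
    exact hle
  -- (5) the frame and the cone at the point over `p'`
  have hSt𝓢 : stalkIdeal (strictTransformIdeal τ s.ker 𝓢) (s₂ (closedPoint O)) = Ideal.span {e (c 0)} := by
    rw [stalkIdeal_strictTransformIdeal_of_not_mem_support s.ker 𝓢 (hoff _), h𝓢, Ideal.map_span, Set.image_singleton, ← hecoe]
    rfl
  have hStK : stalkIdeal (strictTransformIdeal τ s.ker K) (s₂ (closedPoint O)) =
      Ideal.span {MvPolynomial.eval (fun l : Fin 2 => (fun i => e (c i)) l.succ) (MvPolynomial.map (e : _ →+* _) Φ)} := by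
    rw [stalkIdeal_strictTransformIdeal_of_not_mem_support s.ker K (hoff _), hK, Ideal.map_span, Set.image_singleton, ← hecoe,
      ringHom_eval_eq_eval_map]
    rfl
  haveI := hdom
  -- (6) Δ-regularity (res-L1-w45b-stub-2) and the assembly
  have h_sec : s₂ ≫ (τ ≫ σ) ≫ q = 𝟙 _ := by simpa only [Category.assoc] using hs'
  have h_qr : IsQuasiRegular (fun i => e (c i)) := hc.map_ringEquiv e
  have h_dom : IsDomain (X₂.presheaf.stalk (s₂ (closedPoint O)) ⧸ Ideal.span (Set.range fun i => e (c i))) :=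
    isDomain_quotient_span_map_ringEquiv e c
  have h_tail : IsQuasiRegular fun l : Fin 2 => Ideal.Quotient.mk (Ideal.span {(fun i => e (c i)) 0}) ((fun i => e (c i)) l.succ) :=
    isQuasiRegular_tail_map_ringEquiv e c hcb
  have h_hom : (MvPolynomial.map (e : X.presheaf.stalk (τ (s₂ (closedPoint O))) →+* X₂.presheaf.stalk (s₂ (closedPoint O))) Φ).IsHomogeneous m :=
    hΦd.map (e : X.presheaf.stalk (τ (s₂ (closedPoint O))) →+* X₂.presheaf.stalk (s₂ (closedPoint O)))
  have h_modc : MvPolynomial.map (Ideal.Quotient.mk (Ideal.span (Set.range fun i => e (c i))))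
      (MvPolynomial.map (e : X.presheaf.stalk (τ (s₂ (closedPoint O))) →+* X₂.presheaf.stalk (s₂ (closedPoint O))) Φ) ≠ 0 :=
    map_mk_map_ringEquiv_ne_zero e _ _ hspan₂' Φ hΦc
  have h_res : MvPolynomial.map (IsLocalRing.residue (X₂.presheaf.stalk (s₂ (closedPoint O))))
      (MvPolynomial.map (e : X.presheaf.stalk (τ (s₂ (closedPoint O))) →+* X₂.presheaf.stalk (s₂ (closedPoint O))) Φ) ≠ 0 :=
    map_residue_map_ringEquiv_ne_zero e Φ hΦ𝔪
  have h_delta : TCPlus.ConeDeltaRegular (fun i => e (c i))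
      (MvPolynomial.map (e : X.presheaf.stalk (τ (s₂ (closedPoint O))) →+* X₂.presheaf.stalk (s₂ (closedPoint O))) Φ) :=
    TCPlus.coneDeltaRegular_map_ringEquiv e c Φ hΔ
  exact ⟨s₂, h_sec, rfl, hle₂, fun i => e (c i), m,
    MvPolynomial.map (e : X.presheaf.stalk (τ (s₂ (closedPoint O))) →+* X₂.presheaf.stalk (s₂ (closedPoint O))) Φ, hspan₂, h_qr,
    h_dom, h_tail, hSt𝓢, hm, h_hom, hStK, h_modc, h_res, h_delta⟩

end Summit.ResolutionOfSingularities.ResolutionOfSingularities.Cruxes.EquisingularLiftNat.Sections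

end
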